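import Literature.NumberTheory.LFunctions.DeuringHeilbronnSlotSum
import HarnessLib

/-!
# Deuring–Heilbronn for class group `L`-functions, III: removals and pairs of characters

Topic `Literature/NumberTheory/LFunctions` (namespace `Literature.NumberTheory.LFunctions.NumberField.DH`),
continuing `DeuringHeilbronnSlotSum.lean`.  Everything here is PROVED; `Removal` is a structure (data of the
removed indices with their properties), `pairWt`/`pairNode` are definitions with bodies.

* `Removal D β w` — for one character `ψ`: the artificial indices `A` (the two factor indices carrying the
  zeros `{1, 0}` of `Ξ_ψ = ξ(ψ)ξ(ψ⁻¹)` coming from the factors `s(s−1)`, present iff `ψ ≠ 1`) and, when the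
  flag `w` holds, two node indices `B` carrying the exceptional zero `β`; `exists_removal` constructs it
  (`exists_two_indices_of_deriv_eq_zero`);
* `hasSum_pair` — for two characters `ψa, ψb` at the same point `p` (`Re p > 1`) with removals flagged by
  `ψb = 1`, `ψa = 1` respectively ("partner slots"):
  `Σ w' (p − ω)^{−2μ} = 2(δ_a + δ_b)((p−1)^{−2μ} − (p−β)^{−2μ}) − (P_{2μ−1}(ψa,p) + P_{2μ−1}(ψb,p))`;
* `summable_pairWt_mul_norm`, `tsum_pairWt_mul_norm_le` — the `M`-bound of a pair;
* `pairWt_nonneg`, `one_le_pairWt_of_pos`, `exists_pair_idx_of_zero` — weights and the node of a given zero.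

[cite: ThornerZaman2017, §7.2 (7.7)–(7.9)]

## References

* J. Thorner, A. Zaman, Algebra Number Theory 11 (2017), §7. [ThornerZaman2017]
-/

noncomputable section

open scoped NumberField
open Complex Filter Topology Set NumberField NumberField.InfinitePlace Classical

namespace Literature.NumberTheory.LFunctions.NumberField

open Literature.NumberTheory.LFunctions.Stark1974

namespace DH

variable {K : Type*} [Field K] [NumberField K]

/-! ### Removal data -/

/-- The indices removed from one character's node family: the artificial zeros `{1, 0}` (for `ψ ≠ 1`) and,
if `w`, two nodes carrying the exceptional zero `β`. [cite: ThornerZaman2017, §7.2 ("ω ≠ β₁")] -/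
structure Removal {ψ : ClassGroup (𝓞 K) →* ℂˣ} (D : SymmHadamardData (classXiPair K ψ)) (β : ℂ) (w : Prop) where
  /-- factor indices carrying the pair of zeros `{1, 0}` -/
  A : Finset ℕ
  /-- node indices carrying `β` -/
  B : Finset (ℕ × Bool)
  hA : ∀ n ∈ A, D.c n * (1 - 1 / 2) ^ 2 = -1
  hB : ∀ p ∈ B, D.nodeWt p = 1 ∧ D.nodeVal p = β
  hAB : ∀ p ∈ B, p.1 ∉ A
  cardA : (A.card : ℝ) = 2 * (1 - poleInd ψ)
  cardB : (B.card : ℝ) = 2 * (if w then 1 else 0)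

/-- **Existence of the removal data.** [folklore] -/
theorem exists_removal {ψ : ClassGroup (𝓞 K) →* ℂˣ} (D : SymmHadamardData (classXiPair K ψ)) {β : ℂ}
    (hβ : β ≠ 1 / 2) (hβ0 : β ≠ 0) (hβ1 : β ≠ 1) (w : Prop)
    (hw : w → classXiPair K ψ β = 0 ∧ deriv (classXiPair K ψ) β = 0) : Nonempty (Removal D β w) := by
  -- the artificial indices
  have hAex : ∃ A : Finset ℕ, (∀ n ∈ A, D.c n * (1 - 1 / 2) ^ 2 = -1) ∧ (A.card : ℝ) = 2 * (1 - poleInd ψ) := by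
    by_cases hψ : ψ = 1
    · exact ⟨∅, by simp, by simp [poleInd, hψ]⟩
    · obtain ⟨n₁, n₂, hne, h₁, h₂⟩ := D.exists_two_indices_of_deriv_eq_zero (classXiPair_one hψ).1
        (classXiPair_one hψ).2 (by norm_num)
      refine ⟨{n₁, n₂}, ?_, ?_⟩
      · intro n hn
        rcases Finset.mem_insert.mp hn with rfl | hn
        · exact h₁
        · rw [Finset.mem_singleton.mp hn]; exact h₂
      · rw [Finset.card_pair hne]; simp [poleInd, hψ]
  obtain ⟨A, hA, hcardA⟩ := hAex
  -- nodes of the artificial indices are `1` or `0`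
  have hAval : ∀ p : ℕ × Bool, p.1 ∈ A → D.nodeVal p = 1 ∨ D.nodeVal p = 0 := by
    intro p hp
    obtain ⟨b, hb, hb'⟩ := D.nodeVal_pair_of_root (hA p.1 hp)
    rw [sub_self] at hb'
    rcases p with ⟨n, b'⟩
    by_cases hbb : b' = b
    · subst hbb; exact Or.inl hb
    · have : b' = !b := by cases b <;> cases b' <;> simp_all
      subst this; exact Or.inr hb'
  by_cases hwp : w
  · obtain ⟨p₁, p₂, hne, hw1, hw2, hv1, hv2, -, -⟩ := exists_two_idx_of_double D (hw hwp).1 (hw hwp).2 hβ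
    refine ⟨⟨A, {p₁, p₂}, hA, ?_, ?_, hcardA, ?_⟩⟩
    · intro p hp
      rcases Finset.mem_insert.mp hp with rfl | hp
      · exact ⟨hw1, hv1⟩
      · rw [Finset.mem_singleton.mp hp]; exact ⟨hw2, hv2⟩
    · intro p hp hpA
      have hv : D.nodeVal p = β := by
        rcases Finset.mem_insert.mp hp with rfl | hp
        · exact hv1
        · rw [Finset.mem_singleton.mp hp]; exact hv2
      rcases hAval p hpA with h | h
      · exact hβ1 (hv ▸ h)
      · exact hβ0 (hv ▸ h)
    · rw [Finset.card_pair hne]; simp [hwp]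
  · exact ⟨⟨A, ∅, hA, by simp, by simp, hcardA, by simp [hwp]⟩⟩

/-! ### Pairs of characters at a common point -/

section pair

variable {ψa ψb : ClassGroup (𝓞 K) →* ℂˣ} (Da : SymmHadamardData (classXiPair K ψa))
  (Db : SymmHadamardData (classXiPair K ψb)) {β : ℂ}
  (Ra : Removal Da β (ψb = 1)) (Rb : Removal Db β (ψa = 1))

/-- The weights of a pair (with removals). [folklore] -/
def pairWt : SlotIdx ⊕ SlotIdx → ℝ := Sum.elim (slotWt' Da Ra.A Ra.B) (slotWt' Db Rb.A Rb.B)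

/-- The nodes of a pair. [folklore] -/
def pairNode : SlotIdx ⊕ SlotIdx → ℂ := Sum.elim (slotNode Da) (slotNode Db)

omit Ra Rb in
/-- Unfolding `pairNode` on the first slot family. [folklore] -/
@[simp] theorem pairNode_inl (i : SlotIdx) : pairNode Da Db (Sum.inl i) = slotNode Da i := rfl
omit Ra Rb in
/-- Unfolding `pairNode` on the second slot family. [folklore] -/
@[simp] theorem pairNode_inr (i : SlotIdx) : pairNode Da Db (Sum.inr i) = slotNode Db i := rfl
/-- Unfolding `pairWt` on the first slot family. [folklore] -/
@[simp] theorem pairWt_inl (i : SlotIdx) : pairWt Da Db Ra Rb (Sum.inl i) = slotWt' Da Ra.A Ra.B i := rfl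
/-- Unfolding `pairWt` on the second slot family. [folklore] -/
@[simp] theorem pairWt_inr (i : SlotIdx) : pairWt Da Db Ra Rb (Sum.inr i) = slotWt' Db Rb.A Rb.B i := rfl

/-- `poleInd ψ = [ψ = 1]`. [folklore] -/
theorem poleInd_eq (ψ : ClassGroup (𝓞 K) →* ℂˣ) : poleInd ψ = if ψ = 1 then 1 else 0 := rfl

/-- **The node sum of a pair.**  At a point `p` with `Re p > 1`, `μ ≥ 1`:
`Σ w'(p − ω)^{−2μ} = 2(δ_a + δ_b)((p−1)^{−2μ} − (p−β)^{−2μ}) − (P_{2μ−1}(ψa, p) + P_{2μ−1}(ψb, p))`.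
[cite: ThornerZaman2017, §7.2 (7.7)] -/
theorem hasSum_pair {p : ℂ} (hp : 1 < p.re) {μ : ℕ} (hμ : 1 ≤ μ) :
    HasSum (fun j : SlotIdx ⊕ SlotIdx ↦ (pairWt Da Db Ra Rb j : ℂ) * ((p - pairNode Da Db j) ^ (2 * μ))⁻¹)
      (2 * (poleInd ψa + poleInd ψb) * (((p - 1) ^ (2 * μ))⁻¹ - ((p - β) ^ (2 * μ))⁻¹) -
        (pairLSeries K ψa (2 * μ - 1) p + pairLSeries K ψb (2 * μ - 1) p)) := by
  have ha := hasSum_slot_removed Da hp hμ Ra.A Ra.hA Ra.B Ra.hB Ra.hAB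
  have hb := hasSum_slot_removed Db hp hμ Rb.A Rb.hA Rb.B Rb.hB Rb.hAB
  have h := HasSum.sum (f := fun j : SlotIdx ⊕ SlotIdx ↦ (pairWt Da Db Ra Rb j : ℂ) * ((p - pairNode Da Db j) ^ (2 * μ))⁻¹)
    (ha.congr_fun fun i ↦ rfl) (hb.congr_fun fun i ↦ rfl)
  convert h using 1
  have e1 : (Ra.A.card : ℂ) = 2 * (1 - (poleInd ψa : ℂ)) := by
    rw [← Complex.ofReal_natCast, Ra.cardA]; push_cast; ring
  have e2r : (Ra.B.card : ℝ) = 2 * poleInd ψb := by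
    rw [Ra.cardB, poleInd_eq]; split_ifs <;> rfl
  have e2 : (Ra.B.card : ℂ) = 2 * (poleInd ψb : ℂ) := by
    rw [← Complex.ofReal_natCast, e2r]; push_cast; ring
  have e3 : (Rb.A.card : ℂ) = 2 * (1 - (poleInd ψb : ℂ)) := by
    rw [← Complex.ofReal_natCast, Rb.cardA]; push_cast; ring
  have e4r : (Rb.B.card : ℝ) = 2 * poleInd ψa := by
    rw [Rb.cardB, poleInd_eq]; split_ifs <;> rfl
  have e4 : (Rb.B.card : ℂ) = 2 * (poleInd ψa : ℂ) := by
    rw [← Complex.ofReal_natCast, e4r]; push_cast; ring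
  rw [e1, e2, e3, e4]
  ring

/-- **The weights of a pair are `≥ 0`.** [folklore] -/
theorem pairWt_nonneg (j : SlotIdx ⊕ SlotIdx) : 0 ≤ pairWt Da Db Ra Rb j := by
  rcases j with i | i
  · exact (slotWt'_nonneg_le Da Ra.A Ra.B i).1
  · exact (slotWt'_nonneg_le Db Rb.A Rb.B i).1

/-- **A positive weight of a pair is `≥ 1`.** [folklore] -/
theorem one_le_pairWt_of_pos {j : SlotIdx ⊕ SlotIdx} (h : 0 < pairWt Da Db Ra Rb j) : 1 ≤ pairWt Da Db Ra Rb j := by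
  rcases j with i | i
  · exact one_le_slotWt'_of_pos Da Ra.A Ra.B h
  · exact one_le_slotWt'_of_pos Db Rb.A Rb.B h

/-- Nodes of positive weight have `Re ω ≤ 1`. [folklore] -/
theorem pairNode_re_le_one {j : SlotIdx ⊕ SlotIdx} (h : 0 < pairWt Da Db Ra Rb j) : (pairNode Da Db j).re ≤ 1 := by
  rcases j with i | i
  · exact slotNode_re_le_one Da (lt_of_lt_of_le h (slotWt'_nonneg_le Da Ra.A Ra.B i).2)
  · exact slotNode_re_le_one Db (lt_of_lt_of_le h (slotWt'_nonneg_le Db Rb.A Rb.B i).2)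

/-- **Summability of `Σ w' |p − ω|^{−2}` for a pair.** [folklore] -/
theorem summable_pairWt_mul_norm {p : ℂ} (hp : 1 < p.re) :
    Summable fun j : SlotIdx ⊕ SlotIdx ↦ pairWt Da Db Ra Rb j * ‖((p - pairNode Da Db j) ^ 2)⁻¹‖ := by
  have ha := summable_slotWt_mul_norm Da hp
  have hb := summable_slotWt_mul_norm Db hp
  have ha' : Summable fun i : SlotIdx ↦ slotWt' Da Ra.A Ra.B i * ‖((p - slotNode Da i) ^ 2)⁻¹‖ :=
    Summable.of_nonneg_of_le (fun i ↦ mul_nonneg (slotWt'_nonneg_le Da Ra.A Ra.B i).1 (norm_nonneg _))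
      (fun i ↦ mul_le_mul_of_nonneg_right (slotWt'_nonneg_le Da Ra.A Ra.B i).2 (norm_nonneg _)) ha
  have hb' : Summable fun i : SlotIdx ↦ slotWt' Db Rb.A Rb.B i * ‖((p - slotNode Db i) ^ 2)⁻¹‖ :=
    Summable.of_nonneg_of_le (fun i ↦ mul_nonneg (slotWt'_nonneg_le Db Rb.A Rb.B i).1 (norm_nonneg _))
      (fun i ↦ mul_le_mul_of_nonneg_right (slotWt'_nonneg_le Db Rb.A Rb.B i).2 (norm_nonneg _)) hb
  exact Summable.sum (fun j : SlotIdx ⊕ SlotIdx ↦ pairWt Da Db Ra Rb j * ‖((p - pairNode Da Db j) ^ 2)⁻¹‖)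
    (ha'.congr fun i ↦ rfl) (hb'.congr fun i ↦ rfl)

/-- **The `M`-bound of a pair**: `Σ w' |p − ω|^{−2}` is at most the sum of the two one-character bounds.
[cite: ThornerZaman2017, Lemma 7.4] -/
theorem tsum_pairWt_mul_norm_le {p : ℂ} (hp : 1 < p.re) :
    ∑' j : SlotIdx ⊕ SlotIdx, pairWt Da Db Ra Rb j * ‖((p - pairNode Da Db j) ^ 2)⁻¹‖ ≤
      (p.re - 1)⁻¹ * ((2 / p + 2 / (p - 1) + 2 * logDeriv (dedekindGammaFactor K) p).re
          - (pairLSeries K ψa 0 p).re) +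
      (p.re - 1)⁻¹ * ((2 / p + 2 / (p - 1) + 2 * logDeriv (dedekindGammaFactor K) p).re
          - (pairLSeries K ψb 0 p).re) + 4 * Module.finrank ℚ K * zetaTwo := by
  have ha := summable_slotWt_mul_norm Da hp
  have hb := summable_slotWt_mul_norm Db hp
  have hale := tsum_slotWt_mul_norm_le Da hp
  have hble := tsum_slotWt_mul_norm_le Db hp
  have ha' : Summable fun i : SlotIdx ↦ slotWt' Da Ra.A Ra.B i * ‖((p - slotNode Da i) ^ 2)⁻¹‖ :=
    Summable.of_nonneg_of_le (fun i ↦ mul_nonneg (slotWt'_nonneg_le Da Ra.A Ra.B i).1 (norm_nonneg _))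
      (fun i ↦ mul_le_mul_of_nonneg_right (slotWt'_nonneg_le Da Ra.A Ra.B i).2 (norm_nonneg _)) ha
  have hb' : Summable fun i : SlotIdx ↦ slotWt' Db Rb.A Rb.B i * ‖((p - slotNode Db i) ^ 2)⁻¹‖ :=
    Summable.of_nonneg_of_le (fun i ↦ mul_nonneg (slotWt'_nonneg_le Db Rb.A Rb.B i).1 (norm_nonneg _))
      (fun i ↦ mul_le_mul_of_nonneg_right (slotWt'_nonneg_le Db Rb.A Rb.B i).2 (norm_nonneg _)) hb
  have hale' : ∑' i : SlotIdx, slotWt' Da Ra.A Ra.B i * ‖((p - slotNode Da i) ^ 2)⁻¹‖ ≤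
      ∑' i : SlotIdx, slotWt Da i * ‖((p - slotNode Da i) ^ 2)⁻¹‖ :=
    ha'.tsum_le_tsum (fun i ↦ mul_le_mul_of_nonneg_right (slotWt'_nonneg_le Da Ra.A Ra.B i).2 (norm_nonneg _)) ha
  have hble' : ∑' i : SlotIdx, slotWt' Db Rb.A Rb.B i * ‖((p - slotNode Db i) ^ 2)⁻¹‖ ≤
      ∑' i : SlotIdx, slotWt Db i * ‖((p - slotNode Db i) ^ 2)⁻¹‖ :=
    hb'.tsum_le_tsum (fun i ↦ mul_le_mul_of_nonneg_right (slotWt'_nonneg_le Db Rb.A Rb.B i).2 (norm_nonneg _)) hb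
  rw [Summable.tsum_sum (f := fun j : SlotIdx ⊕ SlotIdx ↦ pairWt Da Db Ra Rb j * ‖((p - pairNode Da Db j) ^ 2)⁻¹‖)
    (ha'.congr fun i ↦ rfl) (hb'.congr fun i ↦ rfl)]
  simp only [pairWt_inl, pairWt_inr, pairNode_inl, pairNode_inr]
  linarith

/-- A zero `ρ` of `L(·, ψa)` with `Re ρ > 0`, `ρ ∉ {1, 0, β}` is a node of positive weight of the pair (in the
first character), with that value. [folklore] -/
theorem exists_pair_idx_of_zero {ρ : ℂ} (hρ0 : 0 < ρ.re) (hρ1 : ρ ≠ 1) (hρβ : ρ ≠ β)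
    (hρ : classGroupLFunction K ψa ρ = 0) :
    ∃ j : SlotIdx ⊕ SlotIdx, 0 < pairWt Da Db Ra Rb j ∧ pairNode Da Db j = ρ := by
  obtain ⟨i, hi, hiv⟩ := exists_idx_of_classGroupLFunction_eq_zero Da hρ0 hρ1 hρ
  have hρ00 : ρ ≠ 0 := fun h ↦ by rw [h, zero_re] at hρ0; exact lt_irrefl _ hρ0
  refine ⟨Sum.inl i, ?_, by simpa using hiv⟩
  simp only [pairWt_inl]
  exact slotWt'_pos Da Ra.A Ra.hA Ra.B (fun q hq ↦ (Ra.hB q hq).2) hi (hiv ▸ hρ1) (hiv ▸ hρ00) (hiv ▸ hρβ)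

end pair

end DH

end Literature.NumberTheory.LFunctions.NumberField

end
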